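import Literature.NumberTheory.EllipticCurves.ZpExtensionEisensteinDVRSetting
import Literature.NumberTheory.EllipticCurves.ZpExtensionEisensteinSelmerComplexPlacesProofs
import HarnessLib

/-!
# H.3 is vacuous at the complex places; reduction of `SatisfiesH.h3` for the curve's Eisenstein setting to the finite
# places of `S` (proofs file)

Topic `NumberTheory/EllipticCurves` (D1 road of cell `pub/bsd-print-x9`; companion of `ZpExtensionEisensteinDVRSetting`).
THEOREMS ONLY; no definition, no named fact, no instance, no notation, no `sorry`.

Howard, H.3 [arXiv:1202.6340 p. 7, L62–66]: «`F` is cartesian on every object of `Quot(T)` at every `v ∈ Σ(F)`».  For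
`K` imaginary quadratic the archimedean place is complex, `Γ_{K_w} = 1` and `H¹(K_w, ·) = 0`
(`galoisCohomology.eq_zero_of_isComplex`, p644861), so the clause at `w ∣ ∞` holds for ANY local condition:
* `Howard2004.isCartesianOnQuotAt_inl_of_isComplex` — `IsCartesianOnQuotAt ρ R (Sum.inl w) L` for `w` complex;
* `Howard2004.h3_of_forall_inr` — over a totally complex `K`, `H3 ρ R t` follows from its clauses at the FINITE `v ∈ Σ`;
* **`WeierstrassCurve.eisensteinDVRSetting_h3_of`** — for the Eisenstein setting (`Σ = ∞ ∪ S`): `SatisfiesH.h3` follows from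
  cartesianity of `F_𝔮` at the finite places `v ∈ S` (the remaining, genuinely local-arithmetic clauses: `v ∣ p` ordinary,
  `v ∈ S ∖ {p}` saturated-unramified — owed by the cell's (e)/(e′) seats).
BSD is not proved by any of this.

References: [Howard2004HeegnerKolyvagin] H.3 (arXiv p. 7, L62–66), §3.1; [SerreGaloisCohomology1997] II §1, I §2.2.
-/

set_option autoImplicit false

noncomputable section

open Function NumberField IsDedekindDomain Field
open scoped NumberField ContRepresentation TensorProduct Classical

namespace Literature.NumberTheory.GaloisCohomology.Howard2004

open Literature.NumberTheory.GaloisRepresentations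
open Literature.NumberTheory.GaloisRepresentations.DiscreteGaloisModule

variable {K : Type} [Field K] [NumberField K] {M : Type} [AddCommGroup M] [TopologicalSpace M] [DiscreteTopology M]
  (ρ : DiscreteGaloisModule K M) (R : Type) [CommRing R] [Module R M]

/-- **H.3 is vacuous at a complex place**: all local cohomology groups `H¹(K_w, ·)` vanish (`Γ_{K_w} = 1`), so every
propagated condition equals every pulled-back one. [cite: Howard2004HeegnerKolyvagin, H.3 (arXiv p. 7, L62–66)]
[cite: SerreGaloisCohomology1997, I §2.2] -/
theorem isCartesianOnQuotAt_inl_of_isComplex {w : InfinitePlace K} (hw : w.IsComplex)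
    (L : AddSubgroup (galoisCohomology (ρ.toLocal (Sum.inl w)) 1)) :
    IsCartesianOnQuotAt ρ R (Sum.inl w) L := by
  intro I J N N' _ _ _ _ _ _ _ _ ρI πI ρJ πJ hI hJ r f hf _
  ext x
  have hx : x = 0 := galoisCohomology.eq_zero_of_isComplex ρI hw x
  subst hx
  simp only [zero_mem]

/-- **Over a totally complex `K`, H.3 reduces to the finite places of `Σ`.**
[cite: Howard2004HeegnerKolyvagin, H.3 (arXiv p. 7, L62–66)] -/
theorem h3_of_forall_inr [IsTotallyComplex K] {p : ℕ} (t : SelmerTriple p ρ)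
    (h : ∀ v : HeightOneSpectrum (𝓞 K), (Sum.inr v : Place K) ∈ t.Sigma →
      IsCartesianOnQuotAt ρ R (Sum.inr v) (t.cond (Sum.inr v))) :
    H3 ρ R t := by
  rintro (w | v) hv
  · exact isCartesianOnQuotAt_inl_of_isComplex ρ R (IsTotallyComplex.isComplex w) _
  · exact h v hv

end Literature.NumberTheory.GaloisCohomology.Howard2004

namespace WeierstrassCurve

open Literature.NumberTheory.EllipticCurves Literature.NumberTheory.GaloisRepresentations
open Literature.NumberTheory.GaloisRepresentations.DiscreteGaloisModule
open Literature.NumberTheory.GaloisCohomology.Howard2004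

variable {K : Type} [Field K] [NumberField K] (W : WeierstrassCurve ℚ) [W.IsElliptic] {p : ℕ} [hp : Fact p.Prime]
  (κ : ZpExtension K p) {m : ℕ} (hm : 1 ≤ m)
  (S : Finset (HeightOneSpectrum (𝓞 K)))
  (hpS : ∀ v : HeightOneSpectrum (𝓞 K), ((p : ℕ) : 𝓞 K) ∈ v.asIdeal → v ∈ S)
  (hbad : ∀ v : HeightOneSpectrum (𝓞 K), v ∉ S → ((p : ℕ) : 𝓞 K) ∉ v.asIdeal → (W.baseChange K).HasGoodReductionAt v)
  (L : Set (HeightOneSpectrum (𝓞 K)))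
  (hL : letI := IwasawaAlgebra.isLocalRing_quotient_X_pow_add_C p hm
    L ⊆ (W.eisensteinTower κ hm).degreeTwoPrimes p)
  (hLS : ∀ v ∈ L, v ∉ S)

/-- **`SatisfiesH.h3` for the curve's Eisenstein setting reduces to the finite places of `S`** (`Σ(F_𝔮) = ∞ ∪ S`, `K`
totally complex): cartesianity of `F_𝔮` on `Quot(T^{(k)})` at every `v ∈ S` gives H.3 at level `k`.
[cite: Howard2004HeegnerKolyvagin, H.3 (arXiv p. 7, L62–66) and Def. 3.1.2] -/
theorem eisensteinDVRSetting_h3_of [IsTotallyComplex K]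
    (hfin : letI := IwasawaAlgebra.isLocalRing_quotient_X_pow_add_C p hm
      ∀ k, ∀ v ∈ S, IsCartesianOnQuotAt ((W.eisensteinTower κ hm).ρ k) (IwasawaAlgebra.EisensteinCoeff p m (k + 1))
        (Sum.inr v) ((W.eisensteinTowerTriple κ hm S hpS hbad L hL hLS k).cond (Sum.inr v)))
    (k : ℕ) :
    letI := IwasawaAlgebra.isLocalRing_quotient_X_pow_add_C p hm
    H3 ((W.eisensteinTower κ hm).ρ k) (IwasawaAlgebra.EisensteinCoeff p m (k + 1))
      (W.eisensteinTowerTriple κ hm S hpS hbad L hL hLS k) :=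
  h3_of_forall_inr _ _ _ fun v hv ↦ hfin k v (Finset.inr_mem_disjSum.1 hv)

end WeierstrassCurve

end
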